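import Summits.AtomisticToContinuum.Crystallization.Theorems.ExcessDecayLiouvilleChainRun

/-!
# Route `ExcessDecayLiouville`: reading off the centre at the last scale (nonlinear half, XLI b)

Harmonic-replacement architecture for item `ExcessDecay` (stmt-AtomisticToContinuum-9334), nonlinear half.
`last_scale` — at the final state of the chain (`ChainInv` at scale `σ ≥ L¹⁷`) one more `inv_scale_step` and
`central_value_le` give the displacement of the matched particle of the CENTRE site from the initial approximant:
`‖(π c₀ − c₀) − aff₀ c₀‖` is bounded by the budgets `U⋆, V⋆` and the last-scale floor terms.
All `[folklore]`; helper lemma, nothing here closes an item.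
-/

noncomputable section

namespace Summit.AtomisticToContinuum.Crystallization.Theorems.ExcessDecayLiouville

open scoped BigOperators Topology InnerProductSpace RealInnerProductSpace Classical
open Literature.MathematicalPhysics.StatisticalMechanics
open Summit.AtomisticToContinuum.Crystallization.Theorems.PhononStabilityNegative

local notation "E3" => EuclideanSpace ℝ (Fin 3)

-- Local notation: the force-constant map `K(e)w = h(|e|²)w + 2⟪e,w⟫h′(|e|²)e`.
local notation3 "𝕂[" e "] " w:max =>
  (-((‖e‖ ^ 2)⁻¹) ^ 7 + ((‖e‖ ^ 2)⁻¹) ^ 4) • w + (2 * ⟪e, w⟫ * (7 * ((‖e‖ ^ 2)⁻¹) ^ 8 - 4 * ((‖e‖ ^ 2)⁻¹) ^ 5)) • e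
-- Local notation: the pair force `F(x) = h(|x|²) x`.
local notation3 "𝐅[" x "]" => ((-((‖x‖ ^ 2)⁻¹) ^ 7 + ((‖x‖ ^ 2)⁻¹) ^ 4) • x)
set_option quotPrecheck false in
-- Local notation: ball indicator.
local notation "𝟙ᵇ[" x ", " c ", " R "]" => (if dist (x : EuclideanSpace ℝ (Fin 3)) c ≤ R then (1 : ℝ) else 0)

section

variable {X : Set E3} {c : E3} {r ε δ κ : ℝ} {t : Fin 2 → E3} {A : E3 →L[ℝ] E3} {π : E3 → E3}
  {aff₀ aff : E3 → E3} {a : Fin 2 → E3} {B : E3 →L[ℝ] E3} {c₀ : E3}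

variable (hA : Adm₀ A) (hI : Inner₀ t A)

set_option quotPrecheck false in
-- Local notation: the operator row `(L v)(p)`.
local notation "𝕃" v:max " @ " p:max =>
  tsum (fun q : Sites₀ t A => (if ((p : Sites₀ t A) : E3) ≠ q then 𝕂[((p : Sites₀ t A) : E3) - q] (v ((p : Sites₀ t A) : E3) - v q) else 0))
set_option quotPrecheck false in
-- Local notation: the finite near-neighbour form on the ball of radius `X` about `c₀`.
local notation "NN[" v ", " X "]" =>
  (∑ p ∈ (finite_sites_dist_le (t := t) (A := A) hA hI c₀ X).toFinset,
    ∑ q ∈ (finite_sites_dist_le (t := t) (A := A) hA hI c₀ X).toFinset,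
      (if p ≠ q ∧ dist p q ≤ 11 / 10 then ‖v p - v q‖ ^ 2 else (0 : ℝ)))
set_option quotPrecheck false in
-- local mass on the ball of radius `X` about `c₀`
local notation "𝐌[" f ", " X "]" =>
  tsum (fun p : Sites₀ t A => ‖f (p : E3)‖ ^ 2 * 𝟙ᵇ[p, c₀, X])
set_option quotPrecheck false in
-- Local notation: the displaced self-force `G(p)` of the background `aff`.
local notation "𝐆[" aff "] " p:max =>
  tsum (fun q : Sites₀ t A => (if (p : E3) ≠ q then 𝐅[((p : E3) - q) + (aff (p : E3) - aff q)] else 0))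
set_option quotPrecheck false in
-- Local notation: the radial site cut-off `= 1` on the sites of `B_{r₁}(c)`, `0` beyond `r₁ + w`, slope `1/w`.
local notation "𝛘[" r₁ ", " w "]" =>
  (fun x : EuclideanSpace ℝ (Fin 3) => (if x ∈ Sites₀ t A then max (min 1 ((r₁ + w - dist x c) / w)) 0 else 0))

-- the last step of the chain read at the centre; ~6·10⁵ heartbeats
set_option maxHeartbeats 800000 in
include hA hI in
/-- **Reading off the centre at the last scale** (see the module docstring). [folklore] -/
theorem last_scale (hκ0 : 0 < κ) (hκ1 : κ ≤ 1)
    (hκ : ∀ v : E3 → E3, (Function.support v).Finite →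
      Function.support v ⊆ Sites₀ t A → κ * nnForm t A v ≤ ∑' p : Sites₀ t A, ⟪𝕃 v @ p, v p⟫)
    (hX : X.Finite) (hsep : Sep₀ X δ) (hequil : Equil₀ X) (hδ : 0 < δ) (hδ1 : δ ≤ 1)
    (hε0 : 0 ≤ ε) (hε : 2 * ε < δ) (hr : 192 ≤ r)
    (hXb : ∀ p ∈ X, dist p c ≤ r → ∃ m : Fin 2, ∃ z ∈ Λ₀, dist p (t m + A z) ≤ ε)
    (hπ : ∀ s' ∈ Sites₀ t A, dist s' c ≤ r → π s' ∈ X ∧ dist (π s') s' ≤ ε)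
    (hinj : ∀ s₁ ∈ Sites₀ t A, ∀ s₂ ∈ Sites₀ t A, dist s₁ c ≤ r → dist s₂ c ≤ r → π s₁ = π s₂ → s₁ = s₂)
    (SR : Finset E3) (hSR : ∀ x, x ∈ SR ↔ x ∈ Sites₀ t A ∧ dist x c ≤ r) (hc₀ : dist c₀ c ≤ r / 8)
    (hc₀S : c₀ ∈ Sites₀ t A)
    {Du ν Λs σ₀ γ₀ Ustar Vstar b₀ j₀ Du₀ : ℝ} (hDu0 : 0 ≤ Du) (hDu1 : Du ≤ 1 / 20) (hν : 0 ≤ ν) (hγ₀ : 0 ≤ γ₀)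
    {ja jb : ℝ} (hN : ntotGen κ r δ ε Du ja jb ≤ ν ^ 2 * r ^ 7)
    (Cja : j₀ + 2 * lcOf κ ^ 13 * (Ustar + Du / r ^ 2) ≤ ja) (hja : ja ≤ 1 / 100)
    (Cjb : b₀ + 12 * lcOf κ ^ 8 * (Ustar + Du / r ^ 2) ≤ jb)
    (CΛ : 4000000 * (210000 * ((25 / 23) * (2 * Du + ja) + jb)) ≤ κ / 12)
    (hσ₀r : 737600 * σ₀ ^ 2 + 153600 ≤ r)
    (hDu₀ : ∀ x ∈ SR, ‖(π x - x) - aff₀ x‖ ≤ Du₀)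
    (C1 : lcOf κ ^ 13 * (Ustar / 2 + Du / (4 * r ^ 2)) ≤ κ ^ 2 / 10 ^ 11)
    (C2a : j₀ + 2 * lcOf κ ^ 13 * (Ustar + Du / r ^ 2) ≤ κ / (2 * 10 ^ 10))
    (C2b : b₀ + 12 * lcOf κ ^ 8 * (Ustar + Du / r ^ 2) ≤ κ / (2 * 10 ^ 10))
    (C2c : 2 * r * (b₀ + 12 * lcOf κ ^ 8 * (Ustar + Du / r ^ 2)) ≤ 1 / 100)
    (C3 : Du₀ + lcOf κ ^ 8 * Vstar +
      (lcOf κ ^ 13 + 14 * lcOf κ ^ 8 + 12 * lcOf κ ^ 8 * (5 * r / 4 + 11 / 10)) * (Ustar + Du / r ^ 2) ≤ Du)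
    (C4a : 4000000 * lamOf Du (j₀ + 2 * lcOf κ ^ 13 * (Ustar + Du / r ^ 2)) (b₀ + 12 * lcOf κ ^ 8 * (Ustar + Du / r ^ 2)) ≤ κ / 16)
    (C4b : lamOf Du (j₀ + 2 * lcOf κ ^ 13 * (Ustar + Du / r ^ 2)) (b₀ + 12 * lcOf κ ^ 8 * (Ustar + Du / r ^ 2)) ≤ Λs)
    (hΛs0 : 0 ≤ Λs)
    {σ γ U Vb : ℝ} {aff : E3 → E3} {a : Fin 2 → E3} {B : E3 →L[ℝ] E3}
    (hinv : ChainInv t A π c r c₀ aff₀ (lcOf κ) (phiOf Du r δ) ν Du Ustar Vstar b₀ j₀ σ₀ γ₀ σ γ U Vb aff a B) :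
    ‖(π c₀ - c₀) - aff₀ c₀‖ ≤
      lcOf κ ^ 8 * Vstar + (3 * lcOf κ ^ 13 + 28 * lcOf κ ^ 8) * (Ustar + Du / r ^ 2) +
        lcOf κ ^ 6 * ((1 + Λs * σ ^ 6) * (Ustar + Du / r ^ 2) + σ ^ 7 * phiOf Du r δ + σ ^ 4 * Du / r ^ 2) := by
  obtain ⟨hσ8, hσ64, hσr, hρr, hγ, hUmax, hVmax, hB', ha', hDu, hS⟩ :=
    inv_facts (aff₀ := aff₀) (aff := aff) (a := a) (B := B) hκ0 hκ1 hr SR hSR hc₀ hDu0 hν hγ₀ hδ hσ₀r hDu₀ C3 hinv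
  obtain ⟨z₀, aT, BT, ξ, w, hz₀, hp₀c, hBT, -, hjump, hval, hξ, haff', hrel', hwfin, hW, henv⟩ :=
    inv_scale_step hA hI (aff₀ := aff₀) (aff := aff) (a := a) (B := B) hκ0 hκ1 hκ hX hsep hequil hδ hδ1 hε0 hε hr hXb hπ hinj
      SR hSR hc₀ hDu0 hDu1 hν hγ₀ hN Cja hja Cjb CΛ hσ₀r hDu₀ C1 C2a C2b C2c C3 C4a hinv
  obtain ⟨haff, hrelax, hmass, hBle, hale, hdisp, hU0, hVb0, hpotU, hpotV, hσm, hσσ₀, hγ₀γ⟩ := hinv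
  obtain ⟨hL, -, -⟩ := lcOf_ge hκ0 hκ1
  have hr0 : 0 < r := by linarith
  have hr1 : (1 : ℝ) ≤ r := by linarith
  have hσ0 : 0 < σ := by linarith
  obtain ⟨hχ0, hχS, hχabs, hχ1abs, hχone, hχfar, hχfin⟩ := chainCutoff_props hA hI hr0 SR hSR
  set L := lcOf κ with hLdef
  have hL0 : 0 ≤ L := le_trans (by norm_num) hL
  have hL1 : 1 ≤ L := le_trans (by norm_num) hL
  set Φ := phiOf Du r δ with hΦdef
  have hΦ0 : 0 ≤ Φ := by rw [hΦdef]; unfold phiOf; positivity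
  set S : ℝ := γ * σ + σ ^ 2 * Φ + Du / (σ * r ^ 2) + σ ^ 2 * ν with hSdef
  set V : ℝ := γ * σ ^ 3 + σ ^ 4 * Φ + σ ^ 2 * Du / r ^ 2 with hVdef
  have hS0 : 0 ≤ S := by rw [hSdef]; positivity
  have hV0 : 0 ≤ V := by rw [hVdef]; positivity
  have hShat : S ≤ Ustar / 2 + Du / (4 * r ^ 2) := by unfold sAgg at hS; exact hS
  set Umax := Ustar + Du / r ^ 2 with hUmaxdef
  have hD0 : 0 ≤ Du / r ^ 2 := by positivity
  have hϑσ : 2 * (1 / (4 * L ^ 10)) * (Du / (σ * r ^ 2)) ≤ Du / r ^ 2 := by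
    have hq1 : 2 * (1 / (4 * L ^ 10)) ≤ 1 := by
      rw [show 2 * (1 / (4 * L ^ 10)) = 1 / (2 * L ^ 10) by ring, div_le_one (by positivity)]
      linarith [one_le_pow₀ (M₀ := ℝ) (n := 10) hL1]
    have hq2 : Du / (σ * r ^ 2) ≤ Du / r ^ 2 :=
      div_le_div_of_nonneg_left hDu0 (by positivity) (le_mul_of_one_le_left (by positivity) (by linarith))
    have hq0 : 0 ≤ Du / (σ * r ^ 2) := by positivity
    calc 2 * (1 / (4 * L ^ 10)) * (Du / (σ * r ^ 2)) ≤ 1 * (Du / (σ * r ^ 2)) := mul_le_mul_of_nonneg_right hq1 hq0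
      _ ≤ Du / r ^ 2 := by rw [one_mul]; exact hq2
  have hSU : S ≤ Umax := by
    have h4 : Du / (4 * r ^ 2) = (Du / r ^ 2) / 4 := by rw [div_div, mul_comm]
    have h1 : 0 ≤ γ * σ := by positivity
    have h2 : 0 ≤ σ ^ 2 * (Φ + ν) := by positivity
    have hq0 : 0 ≤ Du / (4 * r ^ 2) := by positivity
    linarith [hpotU, hU0, hϑσ, hShat]
  -- the data thresholds and the Lipschitz modulus
  have hj0 : 0 ≤ ‖a 0 - a 1‖ := norm_nonneg _
  have hb0 : 0 ≤ ‖B‖ := norm_nonneg _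
  have hΛle := lamOf_mono (Du := Du) ha' hB'
  have hΛ1 : lamOf Du ‖a 0 - a 1‖ ‖B‖ ≤ 1 := by linarith
  have hΛs : lamOf Du ‖a 0 - a 1‖ ‖B‖ ≤ Λs := hΛle.trans C4b
  have hΛ0 : 0 ≤ lamOf Du ‖a 0 - a 1‖ ‖B‖ := by unfold lamOf; positivity
  -- the increments in the root variables
  have hΘ₁ := sqrt_thetaOne_le (δ := δ) (ν := ν) hκ0 hκ1 hσ8 hσr hγ hr1 hδ hDu0 hj0 hb0 hΛ1 hν
  have hΘ₂ := sqrt_thetaTwo_le (δ := δ) (ν := ν) hκ0 hκ1 hσ8 hσr hγ hr1 hδ hDu0 hj0 hb0 hΛ1 hν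
  have hVsq := sqrt_vsq_le (δ := δ) hκ0 hκ1 hσ8 hσr hγ hr1 hδ hDu0 hj0 hb0 hΛ1
  have hJp := jump_le_root (δ := δ) (ν := ν) hκ0 hκ1 hσ8 hσr hγ hr1 hδ hDu0 hj0 hb0 hΛ1 hν
  have hXi := xi_le_root (δ := δ) (ν := ν) hκ0 hκ1 hσ8 hσr hγ hr1 hδ hDu0 hj0 hb0 hΛ1 hν
  rw [← hSdef] at hΘ₁ hJp hXi
  have hBTS : ‖BT‖ ≤ 12 * L ^ 8 * S := hBT.trans (by linarith)
  have hξS : ‖ξ‖ ≤ L ^ 13 * S := hξ.trans hXi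
  rw [← hVdef] at hVsq
  have hVa : ∀ m, ‖aT m‖ ≤ L ^ 8 * V + (66 / 5) * L ^ 8 * S := fun m => va_budget (hval m) hVsq hBTS
  -- 𝔖₂ ≤ S (σ ≥ 1)
  have hσ1 : (1 : ℝ) ≤ σ := by linarith
  have hS₂S : γ / σ + Φ + Du / (σ ^ 2 * r ^ 2) + σ ^ 2 * ν ≤ S := by
    rw [hSdef]
    have c1 : γ / σ ≤ γ * σ := (div_le_self hγ hσ1).trans (le_mul_of_one_le_right hγ hσ1)
    have c2 : Φ ≤ σ ^ 2 * Φ := le_mul_of_one_le_left hΦ0 (one_le_pow₀ hσ1)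
    have c3 : Du / (σ ^ 2 * r ^ 2) ≤ Du / (σ * r ^ 2) := by
      refine div_le_div_of_nonneg_left hDu0 (by positivity) ?_
      have : σ ≤ σ ^ 2 := le_self_pow₀ hσ1 (by norm_num)
      exact mul_le_mul_of_nonneg_right this (by positivity)
    linarith
  have hK : 1428 * Real.sqrt (thetaTwoOf κ (σ ^ 2) (γ ^ 2) r δ Du Du ‖a 0 - a 1‖ ‖B‖ (ν ^ 2 * r ^ 7)) ≤ 1428 * L ^ 9 * S := by
    have h1 := mul_le_mul_of_nonneg_left hΘ₂ (by norm_num : (0 : ℝ) ≤ 1428)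
    have h2 := mul_le_mul_of_nonneg_left hS₂S (by positivity : (0 : ℝ) ≤ 1428 * L ^ 9)
    linarith
  -- (1) the centre value of the next cut-off field
  have hcv := central_value_le (t := t) (A := A) (c₀ := c₀)
    (fun x : E3 => 𝛘[r / 2, r / 4] x • ((π x - x) - (aff x + ((if (∃ z ∈ Λ₀, x = t 1 + A z) then aT 1 else aT 0) +
      BT (x - (t 0 + A z₀))) + (if (∃ z ∈ Λ₀, x = t 0 + A z) then ξ else 0))))
    w hwfin henv hW hc₀S (by rw [dist_self]; positivity)
  rw [dist_self, zero_add] at hcv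
  -- χ(c₀) = 1
  have hc₀SR : c₀ ∈ SR := (hSR c₀).2 ⟨hc₀S, by linarith [dist_nonneg (x := c₀) (y := c)]⟩
  have hχc₀ : 𝛘[r / 2, r / 4] c₀ = 1 := hχone c₀ hc₀SR (by linarith)
  simp only [hχc₀, one_smul] at hcv
  -- the two square roots
  have hsq1 : Real.sqrt (3 * (1428 * Real.sqrt (thetaTwoOf κ (σ ^ 2) (γ ^ 2) r δ Du Du ‖a 0 - a 1‖ ‖B‖ (ν ^ 2 * r ^ 7)) *
      (11 / 10) ^ 2) ^ 2 + 3 * ‖ξ‖ ^ 2) ≤ 2 * L ^ 13 * S := by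
    rw [Real.sqrt_le_iff]
    refine ⟨by positivity, ?_⟩
    have hK0 : 0 ≤ 1428 * Real.sqrt (thetaTwoOf κ (σ ^ 2) (γ ^ 2) r δ Du Du ‖a 0 - a 1‖ ‖B‖ (ν ^ 2 * r ^ 7)) := by positivity
    have hK9 : 1428 * Real.sqrt (thetaTwoOf κ (σ ^ 2) (γ ^ 2) r δ Du Du ‖a 0 - a 1‖ ‖B‖ (ν ^ 2 * r ^ 7)) * (11 / 10) ^ 2 ≤
        (121 / 100) * (1428 * L ^ 9 * S) := by
      have := mul_le_mul_of_nonneg_right hK (by norm_num : (0 : ℝ) ≤ (11 / 10) ^ 2)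
      linarith
    have hL4 : (100000 : ℝ) * L ^ 9 ≤ L ^ 13 := by
      have : (100000 : ℝ) ≤ L ^ 4 := le_trans (by norm_num) (le_trans hL (le_self_pow₀ hL1 (by norm_num)))
      calc (100000 : ℝ) * L ^ 9 ≤ L ^ 4 * L ^ 9 := mul_le_mul_of_nonneg_right this (by positivity)
        _ = L ^ 13 := by ring
    have hA1 : (121 / 100) * (1428 * L ^ 9 * S) ≤ (1 / 50) * (L ^ 13 * S) := by
      have h9 := mul_le_mul_of_nonneg_right hL4 hS0
      have h9' : 0 ≤ L ^ 9 * S := mul_nonneg (pow_nonneg hL0 9) hS0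
      linarith
    have h1 : (1428 * Real.sqrt (thetaTwoOf κ (σ ^ 2) (γ ^ 2) r δ Du Du ‖a 0 - a 1‖ ‖B‖ (ν ^ 2 * r ^ 7)) * (11 / 10) ^ 2) ^ 2 ≤
        ((1 / 50) * (L ^ 13 * S)) ^ 2 := pow_le_pow_left₀ (by positivity) (hK9.trans hA1) 2
    have h2 : ‖ξ‖ ^ 2 ≤ (L ^ 13 * S) ^ 2 := pow_le_pow_left₀ (norm_nonneg _) hξS 2
    have h3 : 0 ≤ (L ^ 13 * S) ^ 2 := sq_nonneg _
    linarith
  have hsq2 : Real.sqrt (wsqOf κ (σ ^ 2) (γ ^ 2) r δ Du Du ‖a 0 - a 1‖ ‖B‖) ≤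
      L ^ 6 * (γ + Λs * γ * σ ^ 6 + σ ^ 7 * Φ + σ ^ 4 * Du / r ^ 2) := by
    have h := wsqOf_le (δ := δ) hκ0 hκ1 hσ64 hσr (sq_nonneg γ) hr1 hDu0 hj0 hb0 hΛ1
    rw [Real.sqrt_le_iff]
    refine ⟨by positivity, h.trans ?_⟩
    have hΛ2 : lamOf Du ‖a 0 - a 1‖ ‖B‖ ^ 2 ≤ Λs ^ 2 := pow_le_pow_left₀ hΛ0 hΛs 2
    have h0 : 0 ≤ γ ^ 2 * σ ^ 12 := by positivity
    have h1 := mul_le_mul_of_nonneg_right hΛ2 h0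
    have e : (L ^ 6 * (γ + Λs * γ * σ ^ 6 + σ ^ 7 * Φ + σ ^ 4 * Du / r ^ 2)) ^ 2 =
        L ^ 12 * (γ + Λs * γ * σ ^ 6 + σ ^ 7 * Φ + σ ^ 4 * Du / r ^ 2) ^ 2 := by ring
    rw [e]
    refine mul_le_mul_of_nonneg_left ?_ (by positivity)
    have hx1 : 0 ≤ γ := hγ
    have hx2 : 0 ≤ Λs * γ * σ ^ 6 := by positivity
    have hx3 : 0 ≤ σ ^ 7 * Φ := by positivity
    have hx4 : 0 ≤ σ ^ 4 * Du / r ^ 2 := by positivity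
    have e1 : lamOf Du ‖a 0 - a 1‖ ‖B‖ ^ 2 * γ ^ 2 * (σ ^ 2) ^ 6 = lamOf Du ‖a 0 - a 1‖ ‖B‖ ^ 2 * (γ ^ 2 * σ ^ 12) := by ring
    have e2 : (σ ^ 2) ^ 7 * Φ ^ 2 = (σ ^ 7 * Φ) ^ 2 := by ring
    have e3 : (σ ^ 2) ^ 4 * Du ^ 2 / r ^ 4 = (σ ^ 4 * Du / r ^ 2) ^ 2 := by field_simp
    have e4 : Λs ^ 2 * (γ ^ 2 * σ ^ 12) = (Λs * γ * σ ^ 6) ^ 2 := by ring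
    rw [e1, e2, e3]
    exact sq_sum_ge hx1 hx2 hx3 hx4 (by rw [← e4]; exact h1)
  -- (2) the displacement of the new approximant from the initial one at the centre
  have hdisp' : ‖(aff c₀ + ((if (∃ z ∈ Λ₀, c₀ = t 1 + A z) then aT 1 else aT 0) + BT (c₀ - (t 0 + A z₀))) +
      (if (∃ z ∈ Λ₀, c₀ = t 0 + A z) then ξ else 0)) - aff₀ c₀‖ ≤ L ^ 8 * Vstar + (L ^ 13 + 28 * L ^ 8) * Umax := by
    have h1 := hdisp c₀ hc₀S
    rw [dist_self, zero_add] at h1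
    have hT : ‖(if (∃ z ∈ Λ₀, c₀ = t 1 + A z) then aT 1 else aT 0) + BT (c₀ - (t 0 + A z₀))‖ ≤
        (L ^ 8 * V + (66 / 5) * L ^ 8 * S) + 12 * L ^ 8 * S * (11 / 10) := by
      refine (norm_add_le _ _).trans (add_le_add ?_ ?_)
      · split_ifs
        · exact hVa 1
        · exact hVa 0
      · refine (BT.le_opNorm _).trans ?_
        have hd : ‖c₀ - (t 0 + A z₀)‖ ≤ 11 / 10 := by rw [← dist_eq_norm, dist_comm]; exact hp₀c
        exact mul_le_mul hBTS hd (norm_nonneg _) (by positivity)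
    have hSξ : ‖(if (∃ z ∈ Λ₀, c₀ = t 0 + A z) then ξ else 0)‖ ≤ L ^ 13 * S := by
      split_ifs
      · exact hξS
      · rw [norm_zero]; positivity
    have e : (aff c₀ + ((if (∃ z ∈ Λ₀, c₀ = t 1 + A z) then aT 1 else aT 0) + BT (c₀ - (t 0 + A z₀))) +
        (if (∃ z ∈ Λ₀, c₀ = t 0 + A z) then ξ else 0)) - aff₀ c₀ =
        (aff c₀ - aff₀ c₀) + (((if (∃ z ∈ Λ₀, c₀ = t 1 + A z) then aT 1 else aT 0) + BT (c₀ - (t 0 + A z₀))) +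
          (if (∃ z ∈ Λ₀, c₀ = t 0 + A z) then ξ else 0)) := by abel
    rw [e]
    refine (norm_add_le _ _).trans ?_
    have h2 := (norm_add_le _ _).trans (add_le_add hT hSξ)
    -- U + S ≤ Umax and Vb + V ≤ Vstar
    have hUS : U + S ≤ Umax := by
      have hϑ : 2 * (1 / (4 * L ^ 10)) * (Du / (σ * r ^ 2)) + Du / (σ * r ^ 2) ≤ Du / r ^ 2 := by
        have h8 : Du / (σ * r ^ 2) ≤ (Du / r ^ 2) / 8 := by
          rw [div_div]
          exact div_le_div_of_nonneg_left hDu0 (by positivity) (by rw [mul_comm]; exact mul_le_mul_of_nonneg_right hσ8 (by positivity))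
        have hϑ1 : 2 * (1 / (4 * L ^ 10)) ≤ 1 := by
          rw [show 2 * (1 / (4 * L ^ 10)) = 1 / (2 * L ^ 10) by ring, div_le_one (by positivity)]
          linarith [one_le_pow₀ (M₀ := ℝ) (n := 10) hL1]
        have := mul_le_mul_of_nonneg_right hϑ1 (by positivity : (0 : ℝ) ≤ Du / (σ * r ^ 2))
        linarith
      have h1' : 0 ≤ γ * σ := by positivity
      have h2' : 0 ≤ σ ^ 2 * (Φ + ν) := by positivity
      have h3' : 0 ≤ σ ^ 2 * Φ := by positivity
      have h4' : 0 ≤ σ ^ 2 * ν := by positivity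
      rw [hSdef]; rw [hUmaxdef]
      linarith [hpotU, hϑ, h1', h2']
    have hVV : Vb + V ≤ Vstar := by
      have : Vb + 2 * V ≤ Vstar := by unfold vAgg at hpotV; rw [hVdef]; exact hpotV
      linarith
    have hU0' : 0 ≤ Umax := hU0.trans hUmax
    have m1 := mul_le_mul_of_nonneg_left hVV (pow_nonneg hL0 8)
    have m2 := mul_le_mul_of_nonneg_left hUS (by positivity : (0 : ℝ) ≤ L ^ 13 + 28 * L ^ 8)
    have m3 : 0 ≤ L ^ 8 * S := mul_nonneg (pow_nonneg hL0 8) hS0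
    have m4 : 0 ≤ L ^ 8 * U := mul_nonneg (pow_nonneg hL0 8) hU0
    have m5 : 0 ≤ L ^ 13 * U := mul_nonneg (pow_nonneg hL0 13) hU0
    linarith
  -- (3) assemble
  have e : (π c₀ - c₀) - aff₀ c₀ =
      ((π c₀ - c₀) - (aff c₀ + ((if (∃ z ∈ Λ₀, c₀ = t 1 + A z) then aT 1 else aT 0) + BT (c₀ - (t 0 + A z₀))) +
        (if (∃ z ∈ Λ₀, c₀ = t 0 + A z) then ξ else 0))) +
      ((aff c₀ + ((if (∃ z ∈ Λ₀, c₀ = t 1 + A z) then aT 1 else aT 0) + BT (c₀ - (t 0 + A z₀))) +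
        (if (∃ z ∈ Λ₀, c₀ = t 0 + A z) then ξ else 0)) - aff₀ c₀) := by abel
  rw [e]
  refine (norm_add_le _ _).trans ?_
  have hγU : γ ≤ Umax := by
    have : γ * σ ≤ S := by
      have h3' : 0 ≤ σ ^ 2 * Φ := by positivity
      have h4' : 0 ≤ σ ^ 2 * ν := by positivity
      have h5' : 0 ≤ Du / (σ * r ^ 2) := by positivity
      rw [hSdef]; linarith
    have hγ8 : γ ≤ γ * σ := le_mul_of_one_le_right hγ hσ1
    linarith
  have hlast : Real.sqrt (3 * (1428 * Real.sqrt (thetaTwoOf κ (σ ^ 2) (γ ^ 2) r δ Du Du ‖a 0 - a 1‖ ‖B‖ (ν ^ 2 * r ^ 7)) *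
      (11 / 10) ^ 2) ^ 2 + 3 * ‖ξ‖ ^ 2) + Real.sqrt (wsqOf κ (σ ^ 2) (γ ^ 2) r δ Du Du ‖a 0 - a 1‖ ‖B‖) ≤
      2 * L ^ 13 * Umax + L ^ 6 * ((1 + Λs * σ ^ 6) * Umax + σ ^ 7 * Φ + σ ^ 4 * Du / r ^ 2) := by
    have h1 : 2 * L ^ 13 * S ≤ 2 * L ^ 13 * Umax := mul_le_mul_of_nonneg_left hSU (by positivity)
    have h2 : γ + Λs * γ * σ ^ 6 ≤ (1 + Λs * σ ^ 6) * Umax := by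
      have := mul_le_mul_of_nonneg_left hγU (by positivity : (0 : ℝ) ≤ Λs * σ ^ 6)
      linarith [this, hγU]
    have h3 := mul_le_mul_of_nonneg_left (show γ + Λs * γ * σ ^ 6 + σ ^ 7 * Φ + σ ^ 4 * Du / r ^ 2 ≤
        (1 + Λs * σ ^ 6) * Umax + σ ^ 7 * Φ + σ ^ 4 * Du / r ^ 2 by linarith) (pow_nonneg hL0 6)
    linarith [hsq1, hsq2]
  have hfin : 2 * L ^ 13 * Umax + L ^ 6 * ((1 + Λs * σ ^ 6) * Umax + σ ^ 7 * Φ + σ ^ 4 * Du / r ^ 2) +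
      (L ^ 8 * Vstar + (L ^ 13 + 28 * L ^ 8) * Umax) =
      L ^ 8 * Vstar + (3 * L ^ 13 + 28 * L ^ 8) * Umax + L ^ 6 * ((1 + Λs * σ ^ 6) * Umax + σ ^ 7 * Φ + σ ^ 4 * Du / r ^ 2) := by
    ring
  rw [← hfin]
  exact add_le_add (hcv.trans hlast) hdisp'

end

end Summit.AtomisticToContinuum.Crystallization.Theorems.ExcessDecayLiouville

end
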